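import Mathlib
import HarnessLib

/-!
# Route `BECRewardDescent`, support item `WalkGlue` (stmt-AtomisticToContinuum-12880) — the reward
# curve as an infimum of affine functions: `ℝ≥0∞ ↔ ℝ` bookkeeping

Helper file (does not close the item). In the route the rewarded ground-state energy is the `let`
`R t = ⨅ Ψ : PeriodicTrialState N L, (periodicEnergy v Ψ + ENNReal.ofReal t * (N - n₀(Ψ)))`, an
infimum over trial states of functions AFFINE in the reward `t`, valued in `ℝ≥0∞`; the walk
(`BECRewardDescentWalkGlueBootstrap.lean`) is about the real concave function `t ↦ (R t).toReal` and
its chords. This file proves, for an arbitrary family `i ↦ Eᵢ + t·Dᵢ` with `Dᵢ ≤ M < ∞` and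
`⨅ Eᵢ < ∞` (here: `Dᵢ = N - n₀ ≤ N`, `⨅ Eᵢ = E₀^per < ∞` by `PeriodicEnergyFinite`), exactly the
hypotheses the abstract walk consumes and the translation of its conclusion back:

* `iInf_affine_zero`, `iInf_affine_mono`, `iInf_affine_le_add`, `iInf_affine_concave`,
  `iInf_affine_ne_top` — `R(0) = ⨅E`, monotonicity, the Lipschitz bound `R(t') ≤ R(t) + (t'-t)M`,
  midpoint concavity `aR(t₁) + bR(t₂) ≤ R(at₁ + bt₂)` and finiteness, all in `ℝ≥0∞`;
* `concaveOn_toReal_iInf_affine`, `continuousWithinAt_toReal_iInf_affine` — the real curve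
  `t ↦ (R t).toReal` is concave on `[0, ∞)` and right-continuous at `0`;
* `slope_le_of_ennreal_rung` — the reward-scale rung `R(s₀) ≤ R(0) + s₀τN` (`ℝ≥0∞`) gives
  `chord(s₀) ≤ τN` for the real curve;
* `ennreal_chord_of_real_chord` — the real chord inequality `chord(s) ≤ chord(s₀) + τN` gives the
  subtraction-free `ℝ≥0∞` form `R(s) + (s/s₀)R(0) ≤ R(0) + (s/s₀)R(s₀) + sτN` in which
  `RewardChordBound` is typed.

References: route text of BECRewardDescent, items WalkGlue / RewardChordBound; concavity of a
ground-state energy in a coupling constant [Griffiths1966].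
-/

noncomputable section

open Set Filter Topology

namespace Summit.AtomisticToContinuum.BoseEinsteinCondensation.Theorems.WalkGlue

/-! ### The reward curve as an infimum of affine functions: `ℝ≥0∞` bookkeeping -/

section AffineInf

open scoped ENNReal

variable {ι : Type*} (E D : ι → ℝ≥0∞)

/-- `⨅ᵢ (Eᵢ + 0·Dᵢ) = ⨅ᵢ Eᵢ`: at zero reward the curve is the ground-state energy. [folklore] -/
theorem iInf_affine_zero : (⨅ i, (E i + ENNReal.ofReal 0 * D i)) = ⨅ i, E i := by
  simp

/-- The reward curve is non-decreasing in the reward. [folklore] -/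
theorem iInf_affine_mono {t t' : ℝ} (h : t ≤ t') :
    (⨅ i, (E i + ENNReal.ofReal t * D i)) ≤ ⨅ i, (E i + ENNReal.ofReal t' * D i) :=
  iInf_mono fun i => by gcongr

/-- The reward curve is `M`-Lipschitz when `Dᵢ ≤ M` (depletion `≤ N`):
`R(t') ≤ R(t) + (t' - t)M` for `0 ≤ t ≤ t'`. [folklore] -/
theorem iInf_affine_le_add {M : ℝ≥0∞} (hD : ∀ i, D i ≤ M) {t t' : ℝ} (ht : 0 ≤ t) (h : t ≤ t') :
    (⨅ i, (E i + ENNReal.ofReal t' * D i)) ≤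
      (⨅ i, (E i + ENNReal.ofReal t * D i)) + ENNReal.ofReal (t' - t) * M := by
  rw [ENNReal.iInf_add]
  refine iInf_mono fun i => ?_
  have hsplit : ENNReal.ofReal t' = ENNReal.ofReal t + ENNReal.ofReal (t' - t) := by
    rw [← ENNReal.ofReal_add ht (sub_nonneg.2 h)]
    congr 1
    ring
  rw [hsplit, add_mul, ← add_assoc]
  gcongr
  exact hD i

/-- Concavity of the reward curve (an infimum of functions affine in the reward), in `ℝ≥0∞`:
`a R(t₁) + b R(t₂) ≤ R(a t₁ + b t₂)`. [folklore] -/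
theorem iInf_affine_concave {t₁ t₂ a b : ℝ} (ht₁ : 0 ≤ t₁) (ht₂ : 0 ≤ t₂) (ha : 0 ≤ a)
    (hb : 0 ≤ b) (hab : a + b = 1) :
    ENNReal.ofReal a * (⨅ i, (E i + ENNReal.ofReal t₁ * D i)) +
        ENNReal.ofReal b * (⨅ i, (E i + ENNReal.ofReal t₂ * D i)) ≤
      ⨅ i, (E i + ENNReal.ofReal (a * t₁ + b * t₂) * D i) := by
  refine le_iInf fun i => ?_
  have hab' : ENNReal.ofReal a + ENNReal.ofReal b = 1 := by
    rw [← ENNReal.ofReal_add ha hb, hab, ENNReal.ofReal_one]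
  have hsplit : E i + ENNReal.ofReal (a * t₁ + b * t₂) * D i =
      ENNReal.ofReal a * (E i + ENNReal.ofReal t₁ * D i) +
        ENNReal.ofReal b * (E i + ENNReal.ofReal t₂ * D i) := by
    rw [ENNReal.ofReal_add (mul_nonneg ha ht₁) (mul_nonneg hb ht₂), ENNReal.ofReal_mul ha,
      ENNReal.ofReal_mul hb]
    calc E i + (ENNReal.ofReal a * ENNReal.ofReal t₁ + ENNReal.ofReal b * ENNReal.ofReal t₂) * D i
        = (ENNReal.ofReal a + ENNReal.ofReal b) * E i +
            (ENNReal.ofReal a * ENNReal.ofReal t₁ + ENNReal.ofReal b * ENNReal.ofReal t₂) * D i := by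
          rw [hab', one_mul]
      _ = _ := by ring
  rw [hsplit]
  gcongr <;> exact iInf_le _ i

/-- Finiteness of the reward curve: if `Dᵢ ≤ M < ∞` and the zero-reward infimum is finite, so is
`R(t)` for every `t`. [folklore] -/
theorem iInf_affine_ne_top {M : ℝ≥0∞} (hD : ∀ i, D i ≤ M) (hM : M ≠ ⊤) (hE : (⨅ i, E i) ≠ ⊤)
    (t : ℝ) : (⨅ i, (E i + ENNReal.ofReal t * D i)) ≠ ⊤ := by
  obtain ⟨i, hi⟩ : ∃ i, E i ≠ ⊤ := by
    by_contra h
    push Not at h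
    apply hE
    simp [h]
  exact ne_top_of_le_ne_top (ENNReal.add_ne_top.2
    ⟨hi, ENNReal.mul_ne_top ENNReal.ofReal_ne_top (ne_top_of_le_ne_top hM (hD i))⟩) (iInf_le _ i)

/-- **The real reward curve is concave on `[0, ∞)`.** [folklore] -/
theorem concaveOn_toReal_iInf_affine {M : ℝ≥0∞} (hD : ∀ i, D i ≤ M) (hM : M ≠ ⊤)
    (hE : (⨅ i, E i) ≠ ⊤) :
    ConcaveOn ℝ (Ici 0) (fun t => (⨅ i, (E i + ENNReal.ofReal t * D i)).toReal) := by
  refine ⟨convex_Ici 0, fun t₁ ht₁ t₂ ht₂ a b ha hb hab => ?_⟩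
  simp only [smul_eq_mul]
  have hfin := iInf_affine_ne_top E D hD hM hE
  have h := ENNReal.toReal_mono (hfin _) (iInf_affine_concave E D ht₁ ht₂ ha hb hab)
  rwa [ENNReal.toReal_add (ENNReal.mul_ne_top ENNReal.ofReal_ne_top (hfin _))
    (ENNReal.mul_ne_top ENNReal.ofReal_ne_top (hfin _)),
    ENNReal.toReal_ofReal_mul _ _ ha, ENNReal.toReal_ofReal_mul _ _ hb] at h

/-- **The real reward curve is right-continuous at `0`** (it is `M`-Lipschitz). [folklore] -/
theorem continuousWithinAt_toReal_iInf_affine {M : ℝ≥0∞} (hD : ∀ i, D i ≤ M) (hM : M ≠ ⊤)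
    (hE : (⨅ i, E i) ≠ ⊤) :
    ContinuousWithinAt (fun t => (⨅ i, (E i + ENNReal.ofReal t * D i)).toReal) (Ici 0) 0 := by
  rw [Metric.continuousWithinAt_iff]
  intro ε hε
  refine ⟨ε / (M.toReal + 1), div_pos hε (by positivity), fun t ht hdist => ?_⟩
  have ht0 : 0 ≤ t := ht
  have hfin := iInf_affine_ne_top E D hD hM hE
  have h1 := ENNReal.toReal_mono (hfin t) (iInf_affine_mono E D ht0)
  have h2' := iInf_affine_le_add E D hD le_rfl ht0
  have h2 := ENNReal.toReal_mono
    (ENNReal.add_ne_top.2 ⟨hfin 0, ENNReal.mul_ne_top ENNReal.ofReal_ne_top hM⟩) h2'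
  rw [ENNReal.toReal_add (hfin 0) (ENNReal.mul_ne_top ENNReal.ofReal_ne_top hM),
    ENNReal.toReal_ofReal_mul _ _ (by linarith), sub_zero] at h2
  rw [Real.dist_eq, sub_zero, abs_of_nonneg ht0] at hdist
  rw [Real.dist_eq, abs_of_nonneg (by linarith)]
  have hM0 : 0 ≤ M.toReal := ENNReal.toReal_nonneg
  calc (⨅ i, (E i + ENNReal.ofReal t * D i)).toReal - (⨅ i, (E i + ENNReal.ofReal 0 * D i)).toReal
      ≤ t * M.toReal := by linarith
    _ ≤ t * (M.toReal + 1) := by gcongr; linarith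
    _ < ε := by rwa [lt_div_iff₀ (by positivity)] at hdist

end AffineInf

/-! ### From the real chord inequality to the `ℝ≥0∞` form of `RewardChordBound` -/

section Chord

open scoped ENNReal

/-- **The initial rung in real form.** `R(s₀) ≤ R(0) + s₀τN` in `ℝ≥0∞` (the reward-scale rung)
gives `chord(s₀) ≤ τN` for the real curve. [folklore] -/
theorem slope_le_of_ennreal_rung {Rₑ : ℝ → ℝ≥0∞} {s₀ τ N : ℝ} (hs₀ : 0 < s₀) (hτN : 0 ≤ τ * N)
    (h0 : Rₑ 0 ≠ ⊤) (h : Rₑ s₀ ≤ Rₑ 0 + ENNReal.ofReal (s₀ * τ * N)) :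
    slope (fun t => (Rₑ t).toReal) 0 s₀ ≤ τ * N := by
  have hnn : 0 ≤ s₀ * τ * N := by
    rw [mul_assoc]
    exact mul_nonneg hs₀.le hτN
  have h' := ENNReal.toReal_mono (ENNReal.add_ne_top.2 ⟨h0, ENNReal.ofReal_ne_top⟩) h
  rw [ENNReal.toReal_add h0 ENNReal.ofReal_ne_top, ENNReal.toReal_ofReal hnn] at h'
  rw [slope_def_field, sub_zero, div_le_iff₀ hs₀]
  linarith

/-- **The subtraction-free `ℝ≥0∞` chord inequality** of `RewardChordBound` from the real one:
`chord(s) ≤ chord(s₀) + τN` for the real curve gives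
`R(s) + (s/s₀)R(0) ≤ R(0) + (s/s₀)R(s₀) + sτN` in `ℝ≥0∞`. [folklore] -/
theorem ennreal_chord_of_real_chord {Rₑ : ℝ → ℝ≥0∞} {s s₀ τ N : ℝ} (hs : 0 < s) (hs₀ : 0 < s₀)
    (h0 : Rₑ 0 ≠ ⊤) (hs' : Rₑ s ≠ ⊤) (hs₀' : Rₑ s₀ ≠ ⊤)
    (h : slope (fun t => (Rₑ t).toReal) 0 s ≤ slope (fun t => (Rₑ t).toReal) 0 s₀ + τ * N) :
    Rₑ s + ENNReal.ofReal (s / s₀) * Rₑ 0 ≤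
      Rₑ 0 + ENNReal.ofReal (s / s₀) * Rₑ s₀ + ENNReal.ofReal (s * τ * N) := by
  simp only [slope_def_field, sub_zero] at h
  set a := (Rₑ 0).toReal with ha
  set b := (Rₑ s).toReal with hb
  set c := (Rₑ s₀).toReal with hc
  have hq : 0 ≤ s / s₀ := div_nonneg hs.le hs₀.le
  have hreal : b + s / s₀ * a ≤ a + s / s₀ * c + s * τ * N := by
    rw [div_le_iff₀ hs] at h
    have hid : ((c - a) / s₀ + τ * N) * s = s / s₀ * c - s / s₀ * a + s * τ * N := by ring
    linarith
  calc Rₑ s + ENNReal.ofReal (s / s₀) * Rₑ 0 = ENNReal.ofReal (b + s / s₀ * a) := by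
        rw [ENNReal.ofReal_add ENNReal.toReal_nonneg (mul_nonneg hq ENNReal.toReal_nonneg),
          ENNReal.ofReal_mul hq, ENNReal.ofReal_toReal hs', ENNReal.ofReal_toReal h0]
    _ ≤ ENNReal.ofReal (a + s / s₀ * c + s * τ * N) := ENNReal.ofReal_le_ofReal hreal
    _ ≤ ENNReal.ofReal (a + s / s₀ * c) + ENNReal.ofReal (s * τ * N) := ENNReal.ofReal_add_le
    _ ≤ ENNReal.ofReal a + ENNReal.ofReal (s / s₀ * c) + ENNReal.ofReal (s * τ * N) := by
        gcongr
        exact ENNReal.ofReal_add_le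
    _ = Rₑ 0 + ENNReal.ofReal (s / s₀) * Rₑ s₀ + ENNReal.ofReal (s * τ * N) := by
        rw [ENNReal.ofReal_mul hq, ENNReal.ofReal_toReal h0, ENNReal.ofReal_toReal hs₀']

end Chord

/-! ### Hellmann–Feynman inequalities for an infimum of affine functions (Griffiths' lemma) -/

section HellmannFeynman

/-- **Near-minimiser slope bound, from the left.** If `R` lies below the affine function
`t ↦ e + t·d` at `u - h` and that function is `δ`-near-minimal at `u` (`e + u·d ≤ R(u) + δ`), then
`d ≤ slope(u-h, u) + δ/h`. (For the reward curve: the depletion `n₊(Ψ)` of a `δ`-near-minimiser of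
`F_u` is at most a left difference quotient of `R`.) [folklore] -/
theorem le_slope_add_of_near_min {R : ℝ → ℝ} {e d u h δ : ℝ} (hh : 0 < h)
    (hle : R (u - h) ≤ e + (u - h) * d) (hnear : e + u * d ≤ R u + δ) :
    d ≤ slope R (u - h) u + δ / h := by
  rw [slope_def_field, sub_sub_cancel, ← add_div, le_div_iff₀ hh]
  linarith

/-- **Near-minimiser slope bound, from the right.** If `R` lies below `t ↦ e + t·d` at `u + h` and
that function is `δ`-near-minimal at `u`, then `slope(u, u+h) - δ/h ≤ d`. [folklore] -/
theorem slope_sub_le_of_near_min {R : ℝ → ℝ} {e d u h δ : ℝ} (hh : 0 < h)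
    (hle : R (u + h) ≤ e + (u + h) * d) (hnear : e + u * d ≤ R u + δ) :
    slope R u (u + h) - δ / h ≤ d := by
  rw [slope_def_field, add_sub_cancel_left, ← sub_div, div_le_iff₀ hh]
  linarith

/-- **Hellmann–Feynman, upper half (Griffiths).** For a concave `R` on `[0,∞)` and `u > 0`: for every
`ε > 0` there is `δ > 0` such that every affine minorant `t ↦ e + t·d` of `R` on `[0,∞)` that is
`δ`-near-minimal at `u` has slope `d ≤ R'₋(u) + ε`. (For the reward curve: near-minimisers of `F_u`
have depletion at most the left derivative of `R`, up to `ε`.) [folklore] -/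
theorem near_min_le_leftDeriv_add {R : ℝ → ℝ} (hR : ConcaveOn ℝ (Ici 0) R) {u : ℝ} (hu : 0 < u)
    {ε : ℝ} (hε : 0 < ε) :
    ∃ δ : ℝ, 0 < δ ∧ ∀ e d : ℝ, (∀ t : ℝ, 0 ≤ t → R t ≤ e + t * d) → e + u * d ≤ R u + δ →
      d ≤ derivWithin R (Iio u) u + ε := by
  have hdiff : DifferentiableWithinAt ℝ R (Iio u) u := by
    have h := hR.neg.differentiableWithinAt_Iio_of_mem_interior (by rw [interior_Ici]; exact hu)
    exact differentiableWithinAt_neg_iff.1 h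
  have ht : Tendsto (slope R u) (𝓝[<] u) (𝓝 (derivWithin R (Iio u) u)) :=
    (hasDerivWithinAt_iff_tendsto_slope' self_notMem_Iio).1 hdiff.hasDerivWithinAt
  have hev : ∀ᶠ w in 𝓝[<] u, slope R u w < derivWithin R (Iio u) u + ε / 2 :=
    ht (Iio_mem_nhds (by linarith))
  obtain ⟨w, hw, hwmem⟩ := (hev.and (Ioo_mem_nhdsLT hu)).exists
  refine ⟨ε / 2 * (u - w), mul_pos (half_pos hε) (sub_pos.2 hwmem.2), fun e d hmin hnear => ?_⟩
  have h := le_slope_add_of_near_min (R := R) (sub_pos.2 hwmem.2)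
    (by rw [sub_sub_cancel]; exact hmin w hwmem.1.le) hnear
  rw [sub_sub_cancel, mul_div_assoc, div_self (sub_pos.2 hwmem.2).ne', mul_one, slope_comm] at h
  linarith

/-- **Hellmann–Feynman, lower half (Griffiths).** For a concave `R` on `[0,∞)` and `u > 0`: for every
`ε > 0` there is `δ > 0` such that every affine minorant `t ↦ e + t·d` of `R` on `[0,∞)` that is
`δ`-near-minimal at `u` has slope `d ≥ R'₊(u) - ε`. Together with the upper half: where `R` is
differentiable, the slopes of near-minimal affine minorants converge to `R'(u)`. [folklore] -/
theorem rightDeriv_sub_le_near_min {R : ℝ → ℝ} (hR : ConcaveOn ℝ (Ici 0) R) {u : ℝ} (hu : 0 < u)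
    {ε : ℝ} (hε : 0 < ε) :
    ∃ δ : ℝ, 0 < δ ∧ ∀ e d : ℝ, (∀ t : ℝ, 0 ≤ t → R t ≤ e + t * d) → e + u * d ≤ R u + δ →
      derivWithin R (Ioi u) u - ε ≤ d := by
  have hdiff : DifferentiableWithinAt ℝ R (Ioi u) u := by
    have h := hR.neg.differentiableWithinAt_Ioi_of_mem_interior (by rw [interior_Ici]; exact hu)
    exact differentiableWithinAt_neg_iff.1 h
  have ht : Tendsto (slope R u) (𝓝[>] u) (𝓝 (derivWithin R (Ioi u) u)) :=
    (hasDerivWithinAt_iff_tendsto_slope' self_notMem_Ioi).1 hdiff.hasDerivWithinAt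
  have hev : ∀ᶠ w in 𝓝[>] u, derivWithin R (Ioi u) u - ε / 2 < slope R u w :=
    ht (Ioi_mem_nhds (by linarith))
  obtain ⟨w, hw, hwmem⟩ := (hev.and (Ioo_mem_nhdsGT (lt_add_one u))).exists
  refine ⟨ε / 2 * (w - u), mul_pos (half_pos hε) (sub_pos.2 hwmem.1), fun e d hmin hnear => ?_⟩
  have h := slope_sub_le_of_near_min (R := R) (sub_pos.2 hwmem.1)
    (by rw [add_sub_cancel]; exact hmin w (hu.trans hwmem.1).le) hnear
  rw [add_sub_cancel, mul_div_assoc, div_self (sub_pos.2 hwmem.1).ne', mul_one] at h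
  linarith

end HellmannFeynman

end Summit.AtomisticToContinuum.BoseEinsteinCondensation.Theorems.WalkGlue

end
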